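import Mathlib
import Literature.Computability.MetaComplexity.MultilinearSigmaPiSigmaRefutation
import HarnessLib

/-!
# Homogenisation tools for products of affine forms (ORBIT currency)

Route MonotoneRestoration, crux `OrbitRestorationQP` (stmt-ValiantsHypothesis-18293), line `depth-three-rung`, registered stub
`stub_sigmaPiSigmaKValue` (A_k).  Namespace `Summit.ValiantsHypothesis.ValiantsHypothesis.Theorems.HomogTools`.  Route-independent.

Layer L1′ (a) of the formalisation plan of `Cruxes/OrbitRestorationQP/Lines/depth-three-rung-stubA-bounded-fanin.md` (§1, §8 L1):
the bookkeeping that turns a family of scaled products of AFFINE forms over the variables `τ` into a HOMOGENEOUS `ΣΠΣ(k,d)` formula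
in the tree's vocabulary `Literature.Computability.MetaComplexity.SigmaPiSigma` over the variables `Option τ` (the extra variable
`X none` is the homogenising variable `z`), as required by the named rank bound
`Literature.Computability.AlgebraicComplexity.depthThree_rankBound`:

* `eq_C_add_sum_of_totalDegree_le_one` — the affine normal form of a polynomial of total degree `≤ 1`;
* `hat ℓ` — the homogenised affine form `Σ_x c_x X_(some x) + c₀ X_none` of `ℓ = c₀ + Σ_x c_x X_x`, with `toPoly_hat`;
* `dehom` — dehomogenisation `X_none ↦ 1`, `X_(some x) ↦ X_x`, with `dehom_toPoly_hat : dehom (toPoly (hat ℓ)) = ℓ`;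
* `hterm a d M` — the padded, scaled term `a · z^(d-|M|) · Π_{ℓ ∈ M} hat ℓ` as a list of exactly `d` LINEAR forms
  (`length_hterm`, `hterm_homogeneous`, `termPoly_hterm`, `dehom_termPoly_hterm`, `mem_span_of_mem_hterm`).

Everything is proved. [folklore; cite: SaxenaSeshadhri2013, §1.1 (homogeneous ΣΠΣ(k,d) circuits)]
-/

noncomputable section

open MvPolynomial Literature.Computability.MetaComplexity

-- `Summit.ValiantsHypothesis.ValiantsHypothesis.…` is the tree's single-conjunct layout (Sub = Summit).
set_option linter.dupNamespace false

namespace Summit.ValiantsHypothesis.ValiantsHypothesis.Theorems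

namespace HomogTools

variable {K : Type} [Field K] {τ : Type} [Fintype τ] [DecidableEq τ]

/-! ### Affine normal form -/

omit [Fintype τ] in
/-- An exponent vector of degree `≤ 1` is `0` or a unit vector. [folklore] -/
theorem finsupp_eq_zero_or_single {s : τ →₀ ℕ} (hs : s.degree ≤ 1) : s = 0 ∨ ∃ v, s = Finsupp.single v 1 := by
  classical
  by_cases hs0 : s = 0
  · exact Or.inl hs0
  right
  obtain ⟨v, hv⟩ := DFunLike.ne_iff.mp hs0
  simp only [Finsupp.coe_zero, Pi.zero_apply] at hv
  refine ⟨v, ?_⟩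
  ext w
  by_cases hw : w = v
  · subst hw
    have := Finsupp.le_degree w s
    rw [Finsupp.single_eq_same]
    omega
  · rw [Finsupp.single_eq_of_ne hw]
    by_contra hsw
    have h2 : s v + s w ≤ s.degree := by
      rw [Finsupp.degree_apply]
      calc s v + s w = ∑ i ∈ {v, w}, s i := by rw [Finset.sum_pair (Ne.symm hw)]
        _ ≤ ∑ i ∈ s.support, s i := by
          refine Finset.sum_le_sum_of_subset fun i hi => ?_
          simp only [Finset.mem_insert, Finset.mem_singleton] at hi
          rcases hi with rfl | rfl
          · simpa using hv
          · simpa using hsw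
    omega

/-- **Affine normal form**: a polynomial of total degree `≤ 1` is `C a₀ + Σ_v C a_v · X_v` (adapted from the tree's private
`eq_C_add_sum_of_totalDegree_le_one` in `Literature/Barriers/ValiantsHypothesis/GMT13SymmetricRepresentationsCharTwo.lean`).
[folklore] -/
theorem eq_C_add_sum_of_totalDegree_le_one {p : MvPolynomial τ K} (hp : p.totalDegree ≤ 1) :
    p = C (coeff 0 p) + ∑ v, C (coeff (Finsupp.single v 1) p) * X v := by
  classical
  ext s
  simp only [coeff_add, coeff_C, coeff_sum, coeff_C_mul, coeff_X]
  by_cases hs0 : s = 0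
  · subst hs0
    rw [if_pos rfl, Finset.sum_eq_zero (fun v _ => ?_), add_zero]
    rw [if_neg (Finsupp.single_ne_zero.mpr one_ne_zero), mul_zero]
  rw [if_neg (Ne.symm hs0), zero_add]
  by_cases hs1 : ∃ v, s = Finsupp.single v 1
  · obtain ⟨v, rfl⟩ := hs1
    rw [Finset.sum_eq_single v]
    · rw [if_pos rfl, mul_one]
    · intro w _ hwv
      rw [if_neg (fun h => hwv (Finsupp.single_left_injective one_ne_zero h)), mul_zero]
    · intro h; exact absurd (Finset.mem_univ v) h
  · have hl : coeff s p = 0 := by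
      by_contra h
      have hdeg : s.degree ≤ 1 := (le_totalDegree (mem_support_iff.mpr h)).trans hp
      rcases finsupp_eq_zero_or_single hdeg with h0 | ⟨v, hv⟩
      · exact hs0 h0
      · exact hs1 ⟨v, hv⟩
    rw [hl, eq_comm]
    refine Finset.sum_eq_zero fun v _ => ?_
    rw [if_neg (fun h => hs1 ⟨v, h.symm⟩), mul_zero]

/-! ### Affine forms of the `ΣΠΣ` vocabulary over a finite variable type -/

/-- `toPoly` over a finite variable type as a finite sum. [folklore] -/
theorem toPoly_eq {Y : Type} [Fintype Y] [DecidableEq Y] (ℓ : AffineForm Y K) :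
    AffineForm.toPoly ℓ = (∑ y, C (ℓ.1 y) * X y) + C ℓ.2 := by
  unfold AffineForm.toPoly
  rw [Finsupp.sum_fintype]
  intro y
  simp

/-- The total degree of the polynomial of an affine form is `≤ 1`. [folklore] -/
theorem totalDegree_toPoly_le {Y : Type} [Fintype Y] [DecidableEq Y] (ℓ : AffineForm Y K) :
    (AffineForm.toPoly ℓ).totalDegree ≤ 1 := by
  rw [toPoly_eq]
  refine (totalDegree_add _ _).trans (max_le ?_ ?_)
  · refine (totalDegree_finsetSum _ _).trans (Finset.sup_le fun y _ => ?_)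
    refine (totalDegree_mul _ _).trans ?_
    rw [totalDegree_C, zero_add, totalDegree_X]
  · rw [totalDegree_C]; exact Nat.zero_le _

/-- The coefficient of `X_y` in the polynomial of an affine form. [folklore] -/
theorem coeff_single_toPoly {Y : Type} [Fintype Y] [DecidableEq Y] (ℓ : AffineForm Y K) (y : Y) :
    coeff (Finsupp.single y 1) (AffineForm.toPoly ℓ) = ℓ.1 y := by
  rw [toPoly_eq, coeff_add, coeff_C, if_neg (Ne.symm (Finsupp.single_ne_zero.mpr one_ne_zero)), add_zero,
    coeff_sum, Finset.sum_eq_single y]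
  · rw [coeff_C_mul, coeff_X, if_pos rfl, mul_one]
  · intro w _ hwy
    rw [coeff_C_mul, coeff_X, if_neg (fun h => hwy (Finsupp.single_left_injective one_ne_zero h)), mul_zero]
  · intro h; exact absurd (Finset.mem_univ y) h

/-- The constant coefficient of the polynomial of an affine form. [folklore] -/
theorem coeff_zero_toPoly {Y : Type} [Fintype Y] [DecidableEq Y] (ℓ : AffineForm Y K) :
    coeff 0 (AffineForm.toPoly ℓ) = ℓ.2 := by
  rw [toPoly_eq, coeff_add, coeff_C, if_pos rfl, coeff_sum, Finset.sum_eq_zero, zero_add]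
  intro w _
  rw [coeff_C_mul, coeff_X, if_neg (Finsupp.single_ne_zero.mpr one_ne_zero), mul_zero]

/-- A polynomial of total degree `≤ 1` with a nonzero linear coefficient has total degree exactly `1`. [folklore] -/
theorem totalDegree_eq_one_of_coeff {Y : Type} {p : MvPolynomial Y K} (hp : p.totalDegree ≤ 1) {y : Y}
    (hy : coeff (Finsupp.single y 1) p ≠ 0) : p.totalDegree = 1 := by
  refine le_antisymm hp ?_
  have := le_totalDegree (mem_support_iff.mpr hy)
  simpa [Finsupp.degree_single] using this

/-- The polynomial of an affine form with nonzero linear part has total degree `1`. [folklore] -/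
theorem totalDegree_toPoly_eq_one {Y : Type} [Fintype Y] [DecidableEq Y] {ℓ : AffineForm Y K} (h : ℓ.1 ≠ 0) :
    (AffineForm.toPoly ℓ).totalDegree = 1 := by
  obtain ⟨y, hy⟩ := Finsupp.ne_iff.mp h
  exact totalDegree_eq_one_of_coeff (totalDegree_toPoly_le ℓ) (y := y) (by rwa [coeff_single_toPoly])

/-- A LINEAR form (`ℓ.2 = 0`) computes a homogeneous polynomial of degree `1`. [folklore] -/
theorem isHomogeneous_toPoly {Y : Type} [Fintype Y] [DecidableEq Y] {ℓ : AffineForm Y K} (h : ℓ.2 = 0) :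
    (AffineForm.toPoly ℓ).IsHomogeneous 1 := by
  rw [toPoly_eq, h, C_0, add_zero]
  refine IsHomogeneous.sum _ _ _ fun y _ => ?_
  simpa using (isHomogeneous_C Y (ℓ.1 y)).mul (isHomogeneous_X K y)

/-- Scaling an affine form by a constant. [folklore] -/
def scaleForm {Y : Type} (a : K) (ℓ : AffineForm Y K) : AffineForm Y K := (a • ℓ.1, a * ℓ.2)

/-- `toPoly (scaleForm a ℓ) = C a * toPoly ℓ`. [folklore] -/
theorem toPoly_scaleForm {Y : Type} [Fintype Y] [DecidableEq Y] (a : K) (ℓ : AffineForm Y K) :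
    AffineForm.toPoly (scaleForm a ℓ) = C a * AffineForm.toPoly ℓ := by
  rw [toPoly_eq, toPoly_eq, scaleForm]
  simp only [Finsupp.coe_smul, Pi.smul_apply, smul_eq_mul, map_mul]
  rw [mul_add, Finset.mul_sum]
  congr 1
  exact Finset.sum_congr rfl fun y _ => by ring

/-- Scale the first member of a list of affine forms. [folklore] -/
def scaleFirst {Y : Type} (a : K) : List (AffineForm Y K) → List (AffineForm Y K)
  | [] => []
  | x :: xs => scaleForm a x :: xs

/-- `termPoly (scaleFirst a t) = C a * termPoly t` for a nonempty term. [folklore] -/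
theorem termPoly_scaleFirst {Y : Type} [Fintype Y] [DecidableEq Y] (a : K) {t : List (AffineForm Y K)} (ht : t ≠ []) :
    SigmaPiSigma.termPoly (scaleFirst a t) = C a * SigmaPiSigma.termPoly t := by
  cases t with
  | nil => exact absurd rfl ht
  | cons x xs =>
    simp only [scaleFirst, SigmaPiSigma.termPoly, List.map_cons, List.prod_cons, toPoly_scaleForm, mul_assoc]

/-- `scaleFirst` preserves the length. [folklore] -/
theorem length_scaleFirst {Y : Type} (a : K) (t : List (AffineForm Y K)) : (scaleFirst a t).length = t.length := by
  cases t <;> simp [scaleFirst]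

/-- A member of `t` survives in `scaleFirst a t`, possibly scaled. [folklore] -/
theorem mem_scaleFirst {Y : Type} (a : K) {t : List (AffineForm Y K)} {x : AffineForm Y K} (hx : x ∈ t) :
    x ∈ scaleFirst a t ∨ scaleForm a x ∈ scaleFirst a t := by
  cases t with
  | nil => exact absurd hx (by simp)
  | cons y ys =>
    simp only [scaleFirst, List.mem_cons] at hx ⊢
    rcases hx with rfl | hx
    · exact Or.inr (Or.inl rfl)
    · exact Or.inl (Or.inr hx)

/-- Members of `scaleFirst a t` are members of `t`, possibly scaled. [folklore] -/
theorem mem_of_mem_scaleFirst {Y : Type} (a : K) {t : List (AffineForm Y K)} {x : AffineForm Y K}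
    (hx : x ∈ scaleFirst a t) : x ∈ t ∨ ∃ y ∈ t, x = scaleForm a y := by
  cases t with
  | nil => simp [scaleFirst] at hx
  | cons y ys =>
    simp only [scaleFirst, List.mem_cons] at hx ⊢
    rcases hx with rfl | hx
    · exact Or.inr ⟨y, Or.inl rfl, rfl⟩
    · exact Or.inl (Or.inr hx)

/-! ### Homogenisation of affine forms and dehomogenisation -/

/-- The homogenised affine form of a polynomial of degree `≤ 1`: `c₀ + Σ_x c_x X_x ↦ c₀ X_none + Σ_x c_x X_(some x)` (as a
LINEAR form over `Option τ`). [folklore] -/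
def hat (ℓ : MvPolynomial τ K) : AffineForm (Option τ) K :=
  (Finsupp.equivFunOnFinite.symm fun y => y.elim (coeff 0 ℓ) fun x => coeff (Finsupp.single x 1) ℓ, 0)

/-- The polynomial of `hat ℓ`. [folklore] -/
theorem toPoly_hat (ℓ : MvPolynomial τ K) :
    AffineForm.toPoly (hat ℓ) = (∑ x, C (coeff (Finsupp.single x 1) ℓ) * X (some x)) + C (coeff 0 ℓ) * X none := by
  rw [toPoly_eq, hat]
  simp only [Finsupp.coe_equivFunOnFinite_symm, C_0, add_zero]
  rw [Fintype.sum_option]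
  simp only [Option.elim_none, Option.elim_some]
  rw [add_comm]

omit [DecidableEq τ] in
/-- `hat ℓ` is a linear form. [folklore] -/
@[simp] theorem hat_snd (ℓ : MvPolynomial τ K) : (hat ℓ).2 = 0 := rfl

/-- Dehomogenisation `X_none ↦ 1`, `X_(some x) ↦ X_x`. [folklore] -/
def dehom : MvPolynomial (Option τ) K →ₐ[K] MvPolynomial τ K := aeval fun y => y.elim 1 X

omit [Fintype τ] [DecidableEq τ] in
/-- `dehom (X none) = 1`. [folklore] -/
@[simp] theorem dehom_X_none : dehom (K := K) (τ := τ) (X none) = 1 := by simp [dehom]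

omit [Fintype τ] [DecidableEq τ] in
/-- `dehom (X (some x)) = X x`. [folklore] -/
@[simp] theorem dehom_X_some (x : τ) : dehom (K := K) (X (some x)) = X x := by simp [dehom]

omit [Fintype τ] [DecidableEq τ] in
/-- `dehom (C a) = C a`. [folklore] -/
@[simp] theorem dehom_C (a : K) : dehom (K := K) (τ := τ) (C a) = C a := by simp [dehom]

/-- **Dehomogenising the homogenisation recovers the form.** [folklore] -/
theorem dehom_toPoly_hat {ℓ : MvPolynomial τ K} (hℓ : ℓ.totalDegree ≤ 1) : dehom (AffineForm.toPoly (hat ℓ)) = ℓ := by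
  rw [toPoly_hat, map_add, map_sum, map_mul, dehom_C, dehom_X_none, mul_one]
  simp only [map_mul, dehom_C, dehom_X_some]
  rw [add_comm]
  exact (eq_C_add_sum_of_totalDegree_le_one hℓ).symm

/-- The homogenisation of a polynomial of degree exactly `1` has degree `1` (it is not a multiple of `z`). [folklore] -/
theorem totalDegree_toPoly_hat {ℓ : MvPolynomial τ K} (hℓ : ℓ.totalDegree = 1) :
    (AffineForm.toPoly (hat ℓ)).totalDegree = 1 := by
  classical
  -- some linear coefficient of `ℓ` is nonzero
  have hex : ∃ x, coeff (Finsupp.single x 1) ℓ ≠ 0 := by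
    by_contra h
    push Not at h
    have h1 := eq_C_add_sum_of_totalDegree_le_one hℓ.le
    rw [Finset.sum_eq_zero (fun v _ => by rw [h v, C_0, zero_mul]), add_zero] at h1
    rw [h1, totalDegree_C] at hℓ
    exact zero_ne_one hℓ
  obtain ⟨x, hx⟩ := hex
  refine totalDegree_eq_one_of_coeff (totalDegree_toPoly_le _) (y := some x) ?_
  rw [coeff_single_toPoly]
  simpa [hat] using hx

/-! ### The padded homogenised term -/

/-- The homogenising variable `z = X none` as a linear form. [folklore] -/
def zform : AffineForm (Option τ) K := (Finsupp.single none 1, 0)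

/-- `toPoly zform = X none`. [folklore] -/
@[simp] theorem toPoly_zform : AffineForm.toPoly (zform (K := K) (τ := τ)) = X none := by
  rw [toPoly_eq, zform]
  simp only [C_0, add_zero]
  rw [Finset.sum_eq_single none]
  · simp
  · intro y _ hy; simp [Finsupp.single_eq_of_ne hy]
  · intro h; exact absurd (Finset.mem_univ _) h

/-- **The padded, scaled, homogenised term** `a · z^(d-|M|) · Π_{ℓ ∈ M} hat ℓ` as a list of `d` linear forms (the scalar is
absorbed into the first form). [folklore] -/
def hterm (a : K) (d : ℕ) (M : Multiset (MvPolynomial τ K)) : List (AffineForm (Option τ) K) :=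
  scaleFirst a (List.replicate (d - Multiset.card M) zform ++ M.toList.map hat)

omit [DecidableEq τ] in
/-- `hterm a d M` has length `d` when `|M| ≤ d`. [folklore] -/
theorem length_hterm (a : K) {d : ℕ} {M : Multiset (MvPolynomial τ K)} (h : Multiset.card M ≤ d) :
    (hterm a d M).length = d := by
  rw [hterm, length_scaleFirst, List.length_append, List.length_replicate, List.length_map, Multiset.length_toList]
  omega

omit [DecidableEq τ] in
/-- Every form of `hterm a d M` is linear (constant term `0`). [folklore] -/
theorem hterm_homogeneous (a : K) (d : ℕ) (M : Multiset (MvPolynomial τ K)) : ∀ ℓ ∈ hterm a d M, ℓ.2 = 0 := by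
  intro ℓ hℓ
  have hbase : ∀ x ∈ List.replicate (d - Multiset.card M) zform ++ M.toList.map hat, x.2 = 0 := by
    intro x hx
    rw [List.mem_append, List.mem_replicate, List.mem_map] at hx
    rcases hx with ⟨-, rfl⟩ | ⟨q, -, rfl⟩
    · rfl
    · rfl
  rcases mem_of_mem_scaleFirst a hℓ with h | ⟨y, hy, rfl⟩
  · exact hbase ℓ h
  · rw [scaleForm, hbase y hy, mul_zero]

/-- The polynomial of `hterm a d M`. [folklore] -/
theorem termPoly_hterm (a : K) {d : ℕ} {M : Multiset (MvPolynomial τ K)} (h : Multiset.card M ≤ d) (hd : 1 ≤ d) :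
    SigmaPiSigma.termPoly (hterm a d M) =
      C a * (X none ^ (d - Multiset.card M) * (M.map fun ℓ => AffineForm.toPoly (hat ℓ)).prod) := by
  have hne : List.replicate (d - Multiset.card M) zform ++ M.toList.map hat ≠ [] := by
    intro h0
    have := congrArg List.length h0
    rw [List.length_append, List.length_replicate, List.length_map, Multiset.length_toList, List.length_nil] at this
    omega
  rw [hterm, termPoly_scaleFirst a hne, SigmaPiSigma.termPoly, List.map_append, List.prod_append, List.map_replicate,
    List.prod_replicate, toPoly_zform, List.map_map]
  congr 2
  have : (M.map fun ℓ => AffineForm.toPoly (hat ℓ)) = ((M.toList.map (AffineForm.toPoly ∘ hat) : List _) : Multiset _) := by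
    rw [← Multiset.map_coe, Multiset.coe_toList]
    rfl
  rw [this, Multiset.prod_coe]

/-- **Dehomogenising the padded term recovers the affine product.** [folklore] -/
theorem dehom_termPoly_hterm (a : K) {d : ℕ} {M : Multiset (MvPolynomial τ K)} (h : Multiset.card M ≤ d) (hd : 1 ≤ d)
    (hdeg : ∀ ℓ ∈ M, ℓ.totalDegree ≤ 1) : dehom (SigmaPiSigma.termPoly (hterm a d M)) = C a * M.prod := by
  rw [termPoly_hterm a h hd, map_mul, map_mul, map_pow, dehom_C, dehom_X_none, one_pow, one_mul, map_multiset_prod,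
    Multiset.map_map]
  congr 1
  calc (M.map (⇑dehom ∘ fun ℓ => AffineForm.toPoly (hat ℓ))).prod = (M.map id).prod := by
        congr 1
        exact Multiset.map_congr rfl fun ℓ hℓ => by simpa using dehom_toPoly_hat (hdeg ℓ hℓ)
    _ = M.prod := by rw [Multiset.map_id]

/-- The polynomial of `hterm a d M` is homogeneous of degree `d`. [folklore] -/
theorem isHomogeneous_termPoly {Y : Type} [Fintype Y] [DecidableEq Y] :
    ∀ t : List (AffineForm Y K), (∀ ℓ ∈ t, ℓ.2 = 0) → (SigmaPiSigma.termPoly t).IsHomogeneous t.length := by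
  intro t
  induction t with
  | nil => intro _; simpa [SigmaPiSigma.termPoly] using isHomogeneous_one Y K
  | cons x xs ih =>
    intro h
    have hx : x.2 = 0 := h x (by simp)
    have hxs : ∀ ℓ ∈ xs, ℓ.2 = 0 := fun ℓ hℓ => h ℓ (by simp [hℓ])
    have := (isHomogeneous_toPoly hx).mul (ih hxs)
    simpa [SigmaPiSigma.termPoly, add_comm] using this

/-- **Every homogenised factor lies in the span of the forms of the term** (the first form may carry the scalar `a ≠ 0`).
[folklore] -/
theorem mem_span_of_mem_hterm {a : K} (ha : a ≠ 0) (d : ℕ) {M : Multiset (MvPolynomial τ K)} {ℓ : MvPolynomial τ K}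
    (hℓ : ℓ ∈ M) (S : Set (MvPolynomial (Option τ) K)) (hS : ∀ x ∈ hterm a d M, AffineForm.toPoly x ∈ S) :
    AffineForm.toPoly (hat ℓ) ∈ Submodule.span K S := by
  have hmem : hat ℓ ∈ List.replicate (d - Multiset.card M) zform ++ M.toList.map hat :=
    List.mem_append.2 (Or.inr (List.mem_map.2 ⟨ℓ, Multiset.mem_toList.2 hℓ, rfl⟩))
  rcases mem_scaleFirst a hmem with h | h
  · exact Submodule.subset_span (hS _ h)
  · have h1 : AffineForm.toPoly (scaleForm a (hat ℓ)) ∈ Submodule.span K S := Submodule.subset_span (hS _ h)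
    rw [toPoly_scaleForm, ← smul_eq_C_mul] at h1
    have := Submodule.smul_mem _ a⁻¹ h1
    rwa [smul_smul, inv_mul_cancel₀ ha, one_smul] at this

end HomogTools

end Summit.ValiantsHypothesis.ValiantsHypothesis.Theorems

end
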